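import Mathlib
import HarnessLib

/-!
# Recurrence-relation sequences for Newton's method under an ω-Lipschitz first derivative
# (Ezquerro–Hernández-Verón 2017, §4.2.1 (4.4)–(4.7), (4.11), Lemma 4.8; §4.2.2 (4.14), Lemmas 4.12 and 4.14)

Topic `Literature/Analysis/Calculus`, next to `MajorantNewtonSequence.lean` (Kantorovich's scalar Newton
majorant sequence of §1.1.3) and `CenterLipschitzLocalNewton.lean` (first-derivative conditions of
Argyros 2008).  Chapter 4 of the book studies Newton's method `x_{n+1} = xₙ − [F'(xₙ)]⁻¹ F(xₙ)` under
conditions on `F'` only.  When `F'` is merely *ω-Lipschitz* (§4.2),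

* (Q1) `Γ₀ = [F'(x₀)]⁻¹` exists, `‖Γ₀‖ ≤ β`, `‖Γ₀ F(x₀)‖ ≤ η`;
* (Q2) `‖F'(x) − F'(y)‖ ≤ ω(‖x − y‖)` with `ω : [0, ∞) → ℝ` continuous nondecreasing, `ω(0) = 0`, and
  a continuous nondecreasing `h : [0, 1] → ℝ` with `ω(t z) ≤ h(t) ω(z)` for `t ∈ [0, 1]`, `z ≥ 0`
  (p. 134), `I_h = ∫₀¹ h(t) dt`,

the majorant principle of Chapter 1 is replaced by the *technique of recurrence relations* (§4.2.1): with
`f(t) = 1/(1 − t)` (4.7) one defines the scalar sequences (4.4)–(4.6)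

  `a₀ = η`, `b₀ = β ω(a₀)`, `tₙ = I_h bₙ f(bₙ)`, `aₙ₊₁ = tₙ aₙ`, `bₙ₊₁ = h(tₙ) bₙ f(bₙ)`,

assumes (4.11) `b₀ ≤ 1/(1 + I_h)` and `b₀ < 1 − h(t₀)`, and proves

* **Lemma 4.8** (pp. 135–136): (a) `{tₙ}`, `{aₙ}`, `{bₙ}` are decreasing; (b) `tₙ < 1` and `bₙ < 1` for
  all `n ≥ 0`;

which is the scalar input of the semilocal convergence Theorem 4.9 (`‖x_{n+1} − xₙ‖ ≤ aₙ`,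
`‖Γₙ‖ ω(aₙ) ≤ bₙ`, `R = a₀/(1 − t₀)`).  §4.2.2 specialises to `h(t) = t^d`, `d ∈ (0, 1]`
(`I_h = 1/(1 + d)`), where the estimates sharpen to the single sequence (p. 139)

  `a₀ = β ω(η)`, `aₙ = aₙ₋₁^{1+d} f(aₙ₋₁)^{1+d} / (1 + d)^d` (`n ≥ 1`),

under (4.14) `a₀ ≤ (1 + d)/(2 + d)` and `a₀^d < (1 + d)^d (1 − a₀)^{1+d}`:

* **Lemma 4.12** (p. 139): (a) `{aₙ}` is decreasing; (b) `aₙ ≤ (1 + d)/(2 + d)` for all `n ≥ 0`;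
* **Lemma 4.14** (p. 139): with `γ = a₁/a₀`: (a) `f(γ x) < f(x)` for `γ ∈ (0, 1)`, `x ∈ (0, 1)`;
  (b) `aₙ < γ^{(1+d)^{n−1}} aₙ₋₁` and `aₙ < γ^{((1+d)^n − 1)/d} a₀` for `n ≥ 2`,

the scalar core of the a priori error estimates (4.15) and of the R-order `1 + d` of Theorem 4.15.

This file types the SCALAR statements only (imports `Mathlib` + `HarnessLib`); the operator-level
Theorem 4.9, Theorem 4.11, Lemma 4.13 and Theorem 4.15 consume them in a sibling file.

## Rendering and deviations

* `I_h` is a real parameter `I` with `0 ≤ I` (an operator-level file ties it to `h` through a primitive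
  `H' = h` on `[0, 1]`, `I_h = H(1) − H(0)`); `h : ℝ → ℝ` with `0 ≤ h` on `[0, 1]` and
  `MonotoneOn h (Icc 0 1)` — continuity of `h` is not used by the scalar facts, and `0 ≤ h` on `[0, 1]`
  (which makes `bₙ ≥ 0`) follows from (Q2) as soon as `ω ≢ 0` (`omegaNewtonSeq_h_nonneg`); the
  sequences are hypothesis functions `a b t : ℕ → ℝ` carrying the recursions (4.4)–(4.6) with
  `f(u) = 1/(1 − u)` expanded: `tₙ = I bₙ/(1 − bₙ)`, `bₙ₊₁ = h(tₙ) bₙ/(1 − bₙ)`.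
* Lemma 4.8 (a) is typed as NON-STRICT monotonicity (`bₙ₊₁ ≤ bₙ`, `tₙ₊₁ ≤ tₙ`, `aₙ₊₁ ≤ aₙ`) together
  with the bounds `0 ≤ bₙ ≤ b₀ < 1`, `0 ≤ tₙ ≤ t₀ ≤ 1`, `0 ≤ aₙ ≤ η t₀ⁿ`, `∑_{j<n} aⱼ ≤ η(1 − t₀ⁿ)/(1 − t₀)`:
  the printed strict decrease holds only in the non-degenerate case `η > 0`, `b₀ > 0` that the book
  assumes informally ("we consider the case `b₀ > 0`", p. 135), and the non-strict form is exactly what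
  the proof of Theorem 4.9 uses (`tⱼ < 1`, `bⱼ < 1`, `∏ tₖ ≤ t₀ⁿ`).  From (4.11) alone one gets `t₀ ≤ 1`
  (with equality iff `b₀ = 1/(1 + I_h)`); `t₀ < 1` — needed for `R = a₀/(1 − t₀)` — follows once
  `h(1) ≥ 1`, which (Q2) forces whenever `ω(η) > 0` (`omegaNewtonSeq_t0_lt_one`, `omegaNewtonSeq_h_nonneg`).
* §4.2.2: `d` is a real with `0 < d` (the book takes `d ∈ [0, 1]`; `d = 0` makes (4.14) void), powers
  are `Real.rpow`, and the recursion is typed literally as `aₙ₊₁ = aₙ^{1+d} (1/(1 − aₙ))^{1+d}/(1 + d)^d`.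
  Lemma 4.14 (b) is typed NON-STRICT and for every `n` (`aₙ₊₁ ≤ γ^{(1+d)^n} aₙ`,
  `aₙ ≤ γ^{((1+d)^n − 1)/d} a₀`); the printed strict versions for `n ≥ 2` differ only in degenerate
  cases.  We also record that (4.14b) already forces the STRICT inequality `a₀ < (1 + d)/(2 + d)` in
  (4.14a) (`omegaNewtonSeqPow_a0_lt`), whence `Δ = a₀ f(a₀)/(1 + d) < 1` and the radius
  `R = 1/(1 − Δ)` of Lemma 4.13 / Theorem 4.15 is finite (`omegaNewtonSeqPow_delta_lt_one`).
-/

open Set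

namespace Literature.Analysis.Calculus

/-! ## §4.2.1: the sequences (4.4)–(4.6) under (4.11) — Lemma 4.8 -/

section General

variable {h : ℝ → ℝ} {I η : ℝ} {a b t : ℕ → ℝ}

/-- Monotonicity of `u ↦ I u f(u) = I u/(1 − u)` on `[0, 1)` for `I ≥ 0` ("since `f` is increasing",
proof of Lemma 4.8). [folklore] -/
private theorem onsAux_frac_mono {I u v : ℝ} (hI : 0 ≤ I) (hu : 0 ≤ u) (huv : u ≤ v) (hv : v < 1) :
    0 ≤ I * u / (1 - u) ∧ I * u / (1 - u) ≤ I * v / (1 - v) := by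
  have hu1 : 0 < 1 - u := by linarith
  have hv1 : 0 < 1 - v := by linarith
  refine ⟨div_nonneg (mul_nonneg hI hu) hu1.le, ?_⟩
  rw [div_eq_mul_one_div (I * u), div_eq_mul_one_div (I * v)]
  exact mul_le_mul (mul_le_mul_of_nonneg_left huv hI) (one_div_le_one_div_of_le hv1 (by linarith))
    (div_nonneg zero_le_one hu1.le) (mul_nonneg hI (hu.trans huv))

/-- Under (4.11) one has `b₀ < 1` (so that `f(b₀) = 1/(1 − b₀)` makes sense): `b₀ ≤ 1/(1 + I_h) ≤ 1`,
the case `b₀ = 1` being excluded by `b₀ < 1 − h(t₀)` and `h ≥ 0` on `[0, 1]`.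
[cite: EzquerrofernandezHernandezveron2017, §4.2.1 (4.4), (4.11) and Lemma 4.8 (b) (pp. 135–136)] -/
theorem omegaNewtonSeq_b0_lt_one (hI : 0 ≤ I) (hh0 : ∀ s ∈ Icc (0:ℝ) 1, 0 ≤ h s)
    (ht : ∀ n, t n = I * b n / (1 - b n))
    (h411a : b 0 ≤ 1 / (1 + I)) (h411b : b 0 < 1 - h (t 0)) : b 0 < 1 := by
  have hI1 : 0 < 1 + I := by linarith
  have hb1 : b 0 ≤ 1 := h411a.trans (by rw [div_le_iff₀ hI1]; linarith)
  rcases hb1.lt_or_eq with hlt | heq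
  · exact hlt
  · have ht0 : t 0 = 0 := by rw [ht 0, heq, sub_self, div_zero]
    have h0 := hh0 (t 0) (by rw [ht0]; exact ⟨le_rfl, zero_le_one⟩)
    linarith

/-- Under (4.11): `0 ≤ t₀ ≤ 1`, since `t₀ = I_h b₀ f(b₀) ≤ 1 ⟺ b₀ (1 + I_h) ≤ 1` (Lemma 4.8 (b) at
`n = 0`, non-strict; see `omegaNewtonSeq_t0_lt_one` for `t₀ < 1`).
[cite: EzquerrofernandezHernandezveron2017, §4.2.1 (4.4), (4.11) and Lemma 4.8 (b) (pp. 135–136)] -/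
theorem omegaNewtonSeq_t0_mem (hI : 0 ≤ I) (hh0 : ∀ s ∈ Icc (0:ℝ) 1, 0 ≤ h s) (hb00 : 0 ≤ b 0)
    (ht : ∀ n, t n = I * b n / (1 - b n))
    (h411a : b 0 ≤ 1 / (1 + I)) (h411b : b 0 < 1 - h (t 0)) : 0 ≤ t 0 ∧ t 0 ≤ 1 := by
  have hb1 := omegaNewtonSeq_b0_lt_one hI hh0 ht h411a h411b
  have hI1 : 0 < 1 + I := by linarith
  have hden : 0 < 1 - b 0 := by linarith
  have hbI : b 0 * (1 + I) ≤ 1 := by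
    have := mul_le_mul_of_nonneg_right h411a hI1.le
    rwa [one_div, inv_mul_cancel₀ hI1.ne'] at this
  rw [ht 0]
  refine ⟨div_nonneg (mul_nonneg hI hb00) hden.le, ?_⟩
  rw [div_le_iff₀ hden]
  linarith

/-- **Lemma 4.8** for the sequences `{bₙ}` (4.6) and `{tₙ}` (4.4) under (4.11): for every `n`,
`0 ≤ bₙ ≤ b₀ < 1` and `bₙ₊₁ ≤ bₙ`; `0 ≤ tₙ ≤ t₀ ≤ 1` and `tₙ₊₁ ≤ tₙ` (items (a) and (b), monotonicity in
the non-strict form; the induction of the printed proof: `h(tₙ) ≤ h(t₀) < 1 − b₀ ≤ 1 − bₙ` gives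
`bₙ₊₁ ≤ bₙ`, and `f` increasing gives `tₙ₊₁ ≤ tₙ`).
[cite: EzquerrofernandezHernandezveron2017, §4.2.1 (4.4), (4.6), (4.11), Lemma 4.8 with proof (pp. 135–136)] -/
theorem omegaNewtonSeq_bounds (hI : 0 ≤ I) (hh0 : ∀ s ∈ Icc (0:ℝ) 1, 0 ≤ h s)
    (hhmono : MonotoneOn h (Icc (0:ℝ) 1)) (hb00 : 0 ≤ b 0)
    (ht : ∀ n, t n = I * b n / (1 - b n)) (hb : ∀ n, b (n + 1) = h (t n) * b n / (1 - b n))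
    (h411a : b 0 ≤ 1 / (1 + I)) (h411b : b 0 < 1 - h (t 0)) (n : ℕ) :
    (0 ≤ b n ∧ b n ≤ b 0 ∧ b 0 < 1 ∧ b (n + 1) ≤ b n) ∧
      (0 ≤ t n ∧ t n ≤ t 0 ∧ t 0 ≤ 1 ∧ t (n + 1) ≤ t n) := by
  have hb1 := omegaNewtonSeq_b0_lt_one hI hh0 ht h411a h411b
  obtain ⟨ht00, ht01⟩ := omegaNewtonSeq_t0_mem hI hh0 hb00 ht h411a h411b
  have hmem0 : t 0 ∈ Icc (0:ℝ) 1 := ⟨ht00, ht01⟩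
  -- one step of the induction of the printed proof
  have step : ∀ k, 0 ≤ b k → b k ≤ b 0 →
      (0 ≤ t k ∧ t k ≤ t 0) ∧ (0 ≤ b (k + 1) ∧ b (k + 1) ≤ b k) := by
    intro k hk0 hk1
    have hden : 0 < 1 - b k := by linarith
    obtain ⟨htk0, htk⟩ := onsAux_frac_mono hI hk0 hk1 hb1
    rw [← ht k] at htk0 htk
    rw [← ht 0] at htk
    have hmemk : t k ∈ Icc (0:ℝ) 1 := ⟨htk0, htk.trans ht01⟩
    have hhk : 0 ≤ h (t k) := hh0 _ hmemk
    have hhk' : h (t k) ≤ 1 - b k := by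
      have := hhmono hmemk hmem0 htk
      linarith
    refine ⟨⟨htk0, htk⟩, ?_, ?_⟩
    · rw [hb k]
      exact div_nonneg (mul_nonneg hhk hk0) hden.le
    · rw [hb k, div_le_iff₀ hden]
      calc h (t k) * b k ≤ (1 - b k) * b k := mul_le_mul_of_nonneg_right hhk' hk0
        _ = b k * (1 - b k) := by ring
  have P : ∀ k, 0 ≤ b k ∧ b k ≤ b 0 := by
    intro k
    induction k with
    | zero => exact ⟨hb00, le_rfl⟩
    | succ k ih =>
      obtain ⟨-, h2⟩ := step k ih.1 ih.2
      exact ⟨h2.1, h2.2.trans ih.2⟩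
  obtain ⟨⟨htn0, htn⟩, hbn1, hbn⟩ := step n (P n).1 (P n).2
  refine ⟨⟨(P n).1, (P n).2, hb1, hbn⟩, htn0, htn, ht01, ?_⟩
  have hmono := (onsAux_frac_mono hI hbn1 hbn (lt_of_le_of_lt (P n).2 hb1)).2
  rwa [← ht (n + 1), ← ht n] at hmono

/-- **Lemma 4.8** for the sequence `{aₙ}` (4.5): with `a₀ = η ≥ 0` and `aₙ₊₁ = tₙ aₙ` one has `0 ≤ aₙ`,
`aₙ₊₁ ≤ aₙ` (item (a), non-strict) and the geometric bound `aₙ ≤ η t₀ⁿ` (`aₙ = a₀ ∏_{k<n} tₖ` with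
`tₖ ≤ t₀`, as used in the proof of Theorem 4.9: "`Σ (∏ tₖ) < Σ t₀^{k+1}`").
[cite: EzquerrofernandezHernandezveron2017, §4.2.1 (4.5), Lemma 4.8 (a) with proof, proof of Theorem 4.9 item (ivₙ₊₁) (pp. 135–137)] -/
theorem omegaNewtonSeq_a_bounds (hI : 0 ≤ I) (hh0 : ∀ s ∈ Icc (0:ℝ) 1, 0 ≤ h s)
    (hhmono : MonotoneOn h (Icc (0:ℝ) 1)) (hb00 : 0 ≤ b 0)
    (ht : ∀ n, t n = I * b n / (1 - b n)) (hb : ∀ n, b (n + 1) = h (t n) * b n / (1 - b n))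
    (h411a : b 0 ≤ 1 / (1 + I)) (h411b : b 0 < 1 - h (t 0))
    (hη : 0 ≤ η) (ha0 : a 0 = η) (ha : ∀ n, a (n + 1) = t n * a n) (n : ℕ) :
    0 ≤ a n ∧ a (n + 1) ≤ a n ∧ a n ≤ η * t 0 ^ n := by
  have T := fun k => (omegaNewtonSeq_bounds hI hh0 hhmono hb00 ht hb h411a h411b k).2
  have P : ∀ k, 0 ≤ a k ∧ a k ≤ η * t 0 ^ k := by
    intro k
    induction k with
    | zero => exact ⟨by rw [ha0]; exact hη, le_of_eq (by rw [ha0, pow_zero, mul_one])⟩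
    | succ k ih =>
      obtain ⟨htk0, htk, -, -⟩ := T k
      refine ⟨by rw [ha k]; exact mul_nonneg htk0 ih.1, ?_⟩
      rw [ha k, pow_succ]
      calc t k * a k ≤ t 0 * (η * t 0 ^ k) := mul_le_mul htk ih.2 ih.1 (htk0.trans htk)
        _ = η * (t 0 ^ k * t 0) := by ring
  obtain ⟨-, htn, ht01, -⟩ := T n
  refine ⟨(P n).1, ?_, (P n).2⟩
  rw [ha n]
  calc t n * a n ≤ 1 * a n := mul_le_mul_of_nonneg_right (htn.trans ht01) (P n).1
    _ = a n := one_mul _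

/-- Partial sums of (4.5): `∑_{j<n} aⱼ ≤ η (1 − t₀ⁿ)/(1 − t₀)` when `t₀ < 1` — the estimate behind item
`(ivₙ)` and `‖xₙ₊₁ − x₀‖ < R = a₀/(1 − t₀)` in the proof of Theorem 4.9
(`‖x_{n+1} − x₀‖ ≤ Σ aₖ < (1 − t₀^{n+1}) a₀/(1 − t₀)`).
[cite: EzquerrofernandezHernandezveron2017, §4.2.1 (4.5), proof of Theorem 4.9 item (ivₙ₊₁) (pp. 136–137)] -/
theorem omegaNewtonSeq_sum_le (hI : 0 ≤ I) (hh0 : ∀ s ∈ Icc (0:ℝ) 1, 0 ≤ h s)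
    (hhmono : MonotoneOn h (Icc (0:ℝ) 1)) (hb00 : 0 ≤ b 0)
    (ht : ∀ n, t n = I * b n / (1 - b n)) (hb : ∀ n, b (n + 1) = h (t n) * b n / (1 - b n))
    (h411a : b 0 ≤ 1 / (1 + I)) (h411b : b 0 < 1 - h (t 0))
    (hη : 0 ≤ η) (ha0 : a 0 = η) (ha : ∀ n, a (n + 1) = t n * a n) (ht0 : t 0 < 1) (n : ℕ) :
    ∑ j ∈ Finset.range n, a j ≤ η * (1 - t 0 ^ n) / (1 - t 0) := by
  have A := fun k => omegaNewtonSeq_a_bounds hI hh0 hhmono hb00 ht hb h411a h411b hη ha0 ha k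
  have e : (t 0 ^ n - 1) / (t 0 - 1) = (1 - t 0 ^ n) / (1 - t 0) := by
    rw [← neg_div_neg_eq, neg_sub, neg_sub]
  calc ∑ j ∈ Finset.range n, a j ≤ ∑ j ∈ Finset.range n, η * t 0 ^ j :=
        Finset.sum_le_sum fun j _ => (A j).2.2
    _ = η * ∑ j ∈ Finset.range n, t 0 ^ j := by rw [Finset.mul_sum]
    _ = η * (1 - t 0 ^ n) / (1 - t 0) := by
        rw [geom_sum_eq ht0.ne n, e, mul_div_assoc]

/-- `t₀ < 1` as soon as `h(1) ≥ 1` — which (Q2) forces whenever `ω(η) > 0`, i.e. in the non-trivial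
case `b₀ > 0` of p. 135 (`omegaNewtonSeq_h_nonneg`): otherwise `t₀ = 1` and (4.11) would give
`b₀ < 1 − h(1) ≤ 0`.  This is what makes the radius `R = a₀/(1 − t₀)` of Theorem 4.9 finite.
[cite: EzquerrofernandezHernandezveron2017, §4.2.1 (4.11), Lemma 4.8 (b) and Theorem 4.9 (pp. 135–136)] -/
theorem omegaNewtonSeq_t0_lt_one (hI : 0 ≤ I) (hh0 : ∀ s ∈ Icc (0:ℝ) 1, 0 ≤ h s) (hb00 : 0 ≤ b 0)
    (ht : ∀ n, t n = I * b n / (1 - b n))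
    (h411a : b 0 ≤ 1 / (1 + I)) (h411b : b 0 < 1 - h (t 0)) (hh1 : 1 ≤ h 1) : t 0 < 1 := by
  obtain ⟨-, ht01⟩ := omegaNewtonSeq_t0_mem hI hh0 hb00 ht h411a h411b
  rcases ht01.lt_or_eq with hlt | heq
  · exact hlt
  · rw [heq] at h411b
    linarith

/-- From (Q2): if `ω` is nondecreasing on `[0, ∞)` with `ω(0) = 0`, `ω(t z) ≤ h(t) ω(z)` for
`t ∈ [0, 1]`, `z ≥ 0`, and `ω(z₀) > 0` for some `z₀ ≥ 0` (the non-trivial case `b₀ = β ω(η) > 0` of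
p. 135), then `0 ≤ h` on `[0, 1]` and `1 ≤ h(1)` — the two facts about `h` that the scalar lemmas above
take as hypotheses.
[cite: EzquerrofernandezHernandezveron2017, §4.2 condition (Q2) (p. 134) and §4.2.1, case b₀ > 0 (p. 135)] -/
theorem omegaNewtonSeq_h_nonneg {ω : ℝ → ℝ} (hω0 : ω 0 = 0) (hω : MonotoneOn ω (Ici 0))
    (hωh : ∀ τ ∈ Icc (0:ℝ) 1, ∀ z, 0 ≤ z → ω (τ * z) ≤ h τ * ω z) {z₀ : ℝ} (hz₀ : 0 ≤ z₀)
    (hpos : 0 < ω z₀) : (∀ τ ∈ Icc (0:ℝ) 1, 0 ≤ h τ) ∧ 1 ≤ h 1 := by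
  have hm0 : (0:ℝ) ∈ Ici (0:ℝ) := Set.mem_Ici.2 le_rfl
  refine ⟨fun τ hτ => ?_, ?_⟩
  · have hτz : 0 ≤ τ * z₀ := mul_nonneg hτ.1 hz₀
    have h1 : 0 ≤ ω (τ * z₀) := by
      have := hω hm0 (Set.mem_Ici.2 hτz) hτz
      rwa [hω0] at this
    have h2 := hωh τ hτ z₀ hz₀
    exact le_of_mul_le_mul_right (by rw [zero_mul]; exact h1.trans h2) hpos
  · have h2 := hωh 1 ⟨zero_le_one, le_rfl⟩ z₀ hz₀
    rw [one_mul] at h2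
    exact le_of_mul_le_mul_right (by rw [one_mul]; exact h2) hpos

end General

/-! ## §4.2.2: `h(t) = t^d` — the sequence of p. 139 under (4.14), Lemmas 4.12 and 4.14 -/

section Pow

variable {d γ : ℝ} {a : ℕ → ℝ}

/-- `u ↦ u^d f(u)^{1+d} = u^d (1/(1 − u))^{1+d}` is nondecreasing on `[0, 1)` for `d ≥ 0`. [folklore] -/
private theorem onsAux_G_mono (hd : 0 ≤ d) {u v : ℝ} (hu : 0 ≤ u) (huv : u ≤ v) (hv : v < 1) :
    u ^ d * (1 / (1 - u)) ^ (1 + d) ≤ v ^ d * (1 / (1 - v)) ^ (1 + d) := by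
  have hv1 : 0 < 1 - v := by linarith
  have hu1 : 0 ≤ 1 - u := by linarith
  have h1 : u ^ d ≤ v ^ d := Real.rpow_le_rpow hu huv hd
  have h2 : (1 / (1 - u)) ^ (1 + d) ≤ (1 / (1 - v)) ^ (1 + d) :=
    Real.rpow_le_rpow (div_nonneg zero_le_one hu1) (one_div_le_one_div_of_le hv1 (by linarith))
      (by linarith)
  exact mul_le_mul h1 h2 (Real.rpow_nonneg (div_nonneg zero_le_one hu1) _)
    (Real.rpow_nonneg (hu.trans huv) d)

/-- One step of the recursion of p. 139: for `u ∈ [0, 1)` with `u^d f(u)^{1+d} ≤ (1 + d)^d` one has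
`u^{1+d} f(u)^{1+d}/(1 + d)^d ≤ u`. [folklore] -/
private theorem onsAux_step (hd : 0 < d) {u : ℝ} (hu : 0 ≤ u)
    (hG : u ^ d * (1 / (1 - u)) ^ (1 + d) ≤ (1 + d) ^ d) :
    u ^ (1 + d) * (1 / (1 - u)) ^ (1 + d) / (1 + d) ^ d ≤ u := by
  have hD : 0 < (1 + d) ^ d := Real.rpow_pos_of_pos (by linarith) d
  have e : u ^ (1 + d) = u * u ^ d := by
    rw [add_comm, Real.rpow_add' hu (by linarith : 0 < d + 1).ne', Real.rpow_one, mul_comm]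
  calc u ^ (1 + d) * (1 / (1 - u)) ^ (1 + d) / (1 + d) ^ d
      = u * (u ^ d * (1 / (1 - u)) ^ (1 + d)) / (1 + d) ^ d := by rw [e]; ring
    _ ≤ u := by
        rw [div_le_iff₀ hD]
        exact mul_le_mul_of_nonneg_left hG hu

/-- Strict version of `onsAux_step`: for `u ∈ (0, 1)` with `u^d f(u)^{1+d} < (1 + d)^d` one has
`u^{1+d} f(u)^{1+d}/(1 + d)^d < u`. [folklore] -/
private theorem onsAux_step_lt (hd : 0 < d) {u : ℝ} (hu : 0 < u)
    (hG : u ^ d * (1 / (1 - u)) ^ (1 + d) < (1 + d) ^ d) :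
    u ^ (1 + d) * (1 / (1 - u)) ^ (1 + d) / (1 + d) ^ d < u := by
  have hD : 0 < (1 + d) ^ d := Real.rpow_pos_of_pos (by linarith) d
  have e : u ^ (1 + d) = u * u ^ d := by
    rw [add_comm, Real.rpow_add' hu.le (by linarith : 0 < d + 1).ne', Real.rpow_one, mul_comm]
  calc u ^ (1 + d) * (1 / (1 - u)) ^ (1 + d) / (1 + d) ^ d
      = u * (u ^ d * (1 / (1 - u)) ^ (1 + d)) / (1 + d) ^ d := by rw [e]; ring
    _ < u := by
        rw [div_lt_iff₀ hD]
        exact mul_lt_mul_of_pos_left hG hu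

/-- (4.14b) rewritten as `a₀^d f(a₀)^{1+d} < (1 + d)^d` (for `a₀ < 1`). [folklore] -/
private theorem onsAux_G0 {u : ℝ} (hu1 : u < 1) (h414b : u ^ d < (1 + d) ^ d * (1 - u) ^ (1 + d)) :
    u ^ d * (1 / (1 - u)) ^ (1 + d) < (1 + d) ^ d := by
  have hpos : 0 < (1 - u) ^ (1 + d) := Real.rpow_pos_of_pos (by linarith) _
  rw [Real.div_rpow zero_le_one (by linarith : (0:ℝ) ≤ 1 - u), Real.one_rpow, ← div_eq_mul_one_div,
    div_lt_iff₀ hpos]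
  exact h414b

/-- **Lemma 4.12**: under (4.14) (`a₀ ≤ (1 + d)/(2 + d)` and `a₀^d < (1 + d)^d (1 − a₀)^{1+d}`, with
`a₀ ≥ 0`, `d > 0`) the sequence `aₙ₊₁ = aₙ^{1+d} f(aₙ)^{1+d}/(1 + d)^d` satisfies, for every `n`:
`0 ≤ aₙ ≤ a₀`, (a) `aₙ₊₁ ≤ aₙ` (non-strict form), (b) `aₙ ≤ (1 + d)/(2 + d)`.  ("Immediate" in print: the
step `aₙ₊₁ ≤ aₙ ⟺ aₙ^d f(aₙ)^{1+d} ≤ (1 + d)^d` follows from (4.14b) because `u ↦ u^d f(u)^{1+d}` is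
nondecreasing and `aₙ ≤ a₀`.)
[cite: EzquerrofernandezHernandezveron2017, §4.2.2 (4.14) and Lemma 4.12 (p. 139)] -/
theorem omegaNewtonSeqPow_bounds (hd : 0 < d) (ha00 : 0 ≤ a 0)
    (ha : ∀ n, a (n + 1) = a n ^ (1 + d) * (1 / (1 - a n)) ^ (1 + d) / (1 + d) ^ d)
    (h414a : a 0 ≤ (1 + d) / (2 + d)) (h414b : a 0 ^ d < (1 + d) ^ d * (1 - a 0) ^ (1 + d))
    (n : ℕ) : 0 ≤ a n ∧ a n ≤ a 0 ∧ a (n + 1) ≤ a n ∧ a n ≤ (1 + d) / (2 + d) := by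
  have h2 : (0:ℝ) < 2 + d := by linarith
  have hc1 : (1 + d) / (2 + d) < 1 := by rw [div_lt_one h2]; linarith
  have ha01 : a 0 < 1 := lt_of_le_of_lt h414a hc1
  have hG0 := onsAux_G0 ha01 h414b
  have hD : 0 < (1 + d) ^ d := Real.rpow_pos_of_pos (by linarith) d
  have step : ∀ k, 0 ≤ a k → a k ≤ a 0 → 0 ≤ a (k + 1) ∧ a (k + 1) ≤ a k := by
    intro k hk0 hk1
    have hk1' : a k < 1 := lt_of_le_of_lt hk1 ha01
    refine ⟨?_, ?_⟩
    · rw [ha k]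
      exact div_nonneg (mul_nonneg (Real.rpow_nonneg hk0 _)
        (Real.rpow_nonneg (div_nonneg zero_le_one (by linarith)) _)) hD.le
    · rw [ha k]
      exact onsAux_step hd hk0 ((onsAux_G_mono hd.le hk0 hk1 ha01).trans hG0.le)
  have P : ∀ k, 0 ≤ a k ∧ a k ≤ a 0 := by
    intro k
    induction k with
    | zero => exact ⟨ha00, le_rfl⟩
    | succ k ih =>
      have s := step k ih.1 ih.2
      exact ⟨s.1, s.2.trans ih.2⟩
  exact ⟨(P n).1, (P n).2, (step n (P n).1 (P n).2).2, (P n).2.trans h414a⟩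

/-- (4.14b) forces the STRICT inequality in (4.14a): `a₀ < (1 + d)/(2 + d)` — at `a₀ = (1 + d)/(2 + d)`
one has `1 − a₀ = 1/(2 + d)` and `a₀^d = (1 + d)^d/(2 + d)^d ≥ (1 + d)^d/(2 + d)^{1+d}
= (1 + d)^d (1 − a₀)^{1+d}`, contradicting (4.14b).  Consequently `Δ = a₀ f(a₀)/(1 + d) < 1` and the
radius `R = 1/(1 − Δ)` of Lemma 4.13 (ivₙ) / Theorem 4.15 is finite (`omegaNewtonSeqPow_delta_lt_one`).
[cite: EzquerrofernandezHernandezveron2017, §4.2.2 (4.14), Lemma 4.13 (ivₙ) and Theorem 4.15 (pp. 139–140)] -/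
theorem omegaNewtonSeqPow_a0_lt (hd : 0 < d) (h414a : a 0 ≤ (1 + d) / (2 + d))
    (h414b : a 0 ^ d < (1 + d) ^ d * (1 - a 0) ^ (1 + d)) : a 0 < (1 + d) / (2 + d) := by
  rcases h414a.lt_or_eq with hlt | heq
  · exact hlt
  exfalso
  have h2 : (0:ℝ) < 2 + d := by linarith
  have h2ne : (2:ℝ) + d ≠ 0 := h2.ne'
  have h1c : 1 - a 0 = 1 / (2 + d) := by
    rw [heq, eq_div_iff h2ne, sub_mul, div_mul_cancel₀ _ h2ne]
    ring
  rw [h1c, heq, Real.div_rpow (by linarith : (0:ℝ) ≤ 1 + d) h2.le,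
    Real.div_rpow zero_le_one h2.le, Real.one_rpow] at h414b
  have hD : 0 < (1 + d) ^ d := Real.rpow_pos_of_pos (by linarith) d
  have hP : 0 < (2 + d) ^ d := Real.rpow_pos_of_pos h2 d
  have hPQ : (2 + d) ^ d ≤ (2 + d) ^ (1 + d) :=
    Real.rpow_le_rpow_of_exponent_le (by linarith) (by linarith)
  have hle : (1 + d) ^ d * (1 / (2 + d) ^ (1 + d)) ≤ (1 + d) ^ d / (2 + d) ^ d := by
    rw [div_eq_mul_one_div ((1 + d) ^ d) ((2 + d) ^ d)]
    exact mul_le_mul_of_nonneg_left (one_div_le_one_div_of_le hP hPQ) hD.le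
  linarith

/-- `Δ = a₀ f(a₀)/(1 + d) = a₀/((1 + d)(1 − a₀))` lies in `[0, 1)` under (4.14) — so that
`R = 1/(1 − Δ)` in Lemma 4.13 (ivₙ) and Theorem 4.15 is a finite radius (`Δ < 1 ⟺ a₀ < (1+d)/(2+d)`).
[cite: EzquerrofernandezHernandezveron2017, §4.2.2 (4.14), Lemma 4.13 (ivₙ) and Theorem 4.15 (pp. 139–140)] -/
theorem omegaNewtonSeqPow_delta_lt_one (hd : 0 < d) (ha00 : 0 ≤ a 0)
    (h414a : a 0 ≤ (1 + d) / (2 + d)) (h414b : a 0 ^ d < (1 + d) ^ d * (1 - a 0) ^ (1 + d)) :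
    0 ≤ a 0 * (1 / (1 - a 0)) / (1 + d) ∧ a 0 * (1 / (1 - a 0)) / (1 + d) < 1 := by
  have hlt := omegaNewtonSeqPow_a0_lt hd h414a h414b
  have h2 : (0:ℝ) < 2 + d := by linarith
  have ha1 : a 0 < 1 := hlt.trans ((div_lt_one h2).2 (by linarith))
  have h1a : 0 < 1 - a 0 := by linarith
  have hd1 : (0:ℝ) < 1 + d := by linarith
  refine ⟨div_nonneg (mul_nonneg ha00 (div_nonneg zero_le_one h1a.le)) hd1.le, ?_⟩
  rw [div_lt_one hd1, mul_one_div, div_lt_iff₀ h1a]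
  have h3 := (lt_div_iff₀ h2).1 hlt
  nlinarith

/-- **Lemma 4.14 (a)**: `f(γ x) < f(x)` for `γ ∈ (0, 1)` and `x ∈ (0, 1)`, where `f(t) = 1/(1 − t)`
(4.7) — typed for every `γ < 1` (the lower bound `0 < γ` of the printed statement is not needed).
[cite: EzquerrofernandezHernandezveron2017, §4.2.1 (4.7) and §4.2.2 Lemma 4.14 (a) (pp. 135, 139)] -/
theorem omegaNewtonSeqPow_f_lt {x : ℝ} (hγ1 : γ < 1) (hx0 : 0 < x) (hx1 : x < 1) :
    1 / (1 - γ * x) < 1 / (1 - x) := by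
  apply one_div_lt_one_div_of_lt (by linarith)
  nlinarith [mul_pos (sub_pos.2 hγ1) hx0]

/-- `γ = a₁/a₀ ∈ (0, 1)` under (4.14) when `a₀ > 0` (Lemma 4.14: "`γ < 1`"; `a₁ < a₀` is exactly
(4.14b), and `a₁ > 0`).
[cite: EzquerrofernandezHernandezveron2017, §4.2.2 (4.14), Lemma 4.12 (a) and Lemma 4.14 (p. 139)] -/
theorem omegaNewtonSeqPow_ratio (hd : 0 < d) (ha0 : 0 < a 0)
    (ha : ∀ n, a (n + 1) = a n ^ (1 + d) * (1 / (1 - a n)) ^ (1 + d) / (1 + d) ^ d)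
    (h414a : a 0 ≤ (1 + d) / (2 + d)) (h414b : a 0 ^ d < (1 + d) ^ d * (1 - a 0) ^ (1 + d)) :
    0 < a 1 / a 0 ∧ a 1 / a 0 < 1 := by
  have hlt := omegaNewtonSeqPow_a0_lt hd h414a h414b
  have h2 : (0:ℝ) < 2 + d := by linarith
  have ha01 : a 0 < 1 := hlt.trans ((div_lt_one h2).2 (by linarith))
  have hG0 := onsAux_G0 ha01 h414b
  have hD : 0 < (1 + d) ^ d := Real.rpow_pos_of_pos (by linarith) d
  have ha1pos : 0 < a 1 := by
    rw [ha 0]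
    exact div_pos (mul_pos (Real.rpow_pos_of_pos ha0 _)
      (Real.rpow_pos_of_pos (div_pos one_pos (by linarith)) _)) hD
  have ha1lt : a 1 < a 0 := by
    rw [ha 0]
    exact onsAux_step_lt hd ha0 hG0
  exact ⟨div_pos ha1pos ha0, (div_lt_one ha0).2 ha1lt⟩

/-- **Lemma 4.14 (b)**, first inequality, non-strict and for every `n`: `aₙ₊₁ ≤ γ^{(1+d)^n} aₙ` with
`γ = a₁/a₀` (printed: `aₙ < γ^{(1+d)^{n−1}} aₙ₋₁` for `n ≥ 2`; the induction of the printed proof: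
`aₙ₊₁ = aₙ^{1+d} f(aₙ)^{1+d}/(1+d)^d ≤ (γ^k aₙ₋₁)^{1+d} f(aₙ₋₁)^{1+d}/(1+d)^d = γ^{k(1+d)} aₙ`).
[cite: EzquerrofernandezHernandezveron2017, §4.2.2 Lemma 4.14 (b) with proof (p. 139)] -/
theorem omegaNewtonSeqPow_succ_le (hd : 0 < d) (ha0 : 0 < a 0)
    (ha : ∀ n, a (n + 1) = a n ^ (1 + d) * (1 / (1 - a n)) ^ (1 + d) / (1 + d) ^ d)
    (h414a : a 0 ≤ (1 + d) / (2 + d)) (h414b : a 0 ^ d < (1 + d) ^ d * (1 - a 0) ^ (1 + d))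
    (hγ : γ = a 1 / a 0) (n : ℕ) : a (n + 1) ≤ γ ^ ((1 + d) ^ n) * a n := by
  have B := omegaNewtonSeqPow_bounds hd ha0.le ha h414a h414b
  obtain ⟨hγ0, -⟩ := omegaNewtonSeqPow_ratio hd ha0 ha h414a h414b
  rw [← hγ] at hγ0
  have h2 : (0:ℝ) < 2 + d := by linarith
  have ha01 : a 0 < 1 :=
    (omegaNewtonSeqPow_a0_lt hd h414a h414b).trans ((div_lt_one h2).2 (by linarith))
  induction n with
  | zero =>
    apply le_of_eq
    rw [zero_add, pow_zero, Real.rpow_one, hγ, div_mul_cancel₀ _ ha0.ne']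
  | succ n ih =>
    obtain ⟨hn0, hn1, -, -⟩ := B n
    obtain ⟨hn0', hn1', -, -⟩ := B (n + 1)
    have han1 : a n < 1 := lt_of_le_of_lt hn1 ha01
    have han1' : a (n + 1) < 1 := lt_of_le_of_lt hn1' ha01
    have hstep : a (n + 1) ≤ a n := (B n).2.2.1
    have hγk : 0 ≤ γ ^ ((1 + d) ^ n) := (Real.rpow_pos_of_pos hγ0 _).le
    have hD : 0 < (1 + d) ^ d := Real.rpow_pos_of_pos (by linarith) d
    have h1 : a (n + 1) ^ (1 + d) ≤ (γ ^ ((1 + d) ^ n) * a n) ^ (1 + d) :=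
      Real.rpow_le_rpow hn0' ih (by linarith)
    have h2' : (1 / (1 - a (n + 1))) ^ (1 + d) ≤ (1 / (1 - a n)) ^ (1 + d) :=
      Real.rpow_le_rpow (div_nonneg zero_le_one (by linarith))
        (one_div_le_one_div_of_le (by linarith) (by linarith)) (by linarith)
    rw [ha (n + 1)]
    calc a (n + 1) ^ (1 + d) * (1 / (1 - a (n + 1))) ^ (1 + d) / (1 + d) ^ d
        ≤ (γ ^ ((1 + d) ^ n) * a n) ^ (1 + d) * (1 / (1 - a n)) ^ (1 + d) / (1 + d) ^ d := by
          exact div_le_div_of_nonneg_right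
            (mul_le_mul h1 h2' (Real.rpow_nonneg (div_nonneg zero_le_one (by linarith)) _)
              (Real.rpow_nonneg (mul_nonneg hγk hn0) _)) hD.le
      _ = γ ^ ((1 + d) ^ n * (1 + d)) *
            (a n ^ (1 + d) * (1 / (1 - a n)) ^ (1 + d) / (1 + d) ^ d) := by
          rw [Real.mul_rpow hγk hn0, Real.rpow_mul hγ0.le]
          ring
      _ = γ ^ ((1 + d) ^ (n + 1)) * a (n + 1) := by rw [← ha n, pow_succ]

/-- **Lemma 4.14 (b)**, second inequality, non-strict and for every `n`: `aₙ ≤ γ^{((1+d)^n − 1)/d} a₀`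
with `γ = a₁/a₀ ∈ (0, 1)` (printed strict for `n ≥ 2`) — super-geometric decay of order `1 + d`, the
scalar core of the a priori estimate (4.15) and of the R-order `1 + d` in Theorem 4.15.
[cite: EzquerrofernandezHernandezveron2017, §4.2.2 Lemma 4.14 (b) with proof and Theorem 4.15 (pp. 139–140)] -/
theorem omegaNewtonSeqPow_le_init (hd : 0 < d) (ha0 : 0 < a 0)
    (ha : ∀ n, a (n + 1) = a n ^ (1 + d) * (1 / (1 - a n)) ^ (1 + d) / (1 + d) ^ d)
    (h414a : a 0 ≤ (1 + d) / (2 + d)) (h414b : a 0 ^ d < (1 + d) ^ d * (1 - a 0) ^ (1 + d))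
    (hγ : γ = a 1 / a 0) (n : ℕ) : a n ≤ γ ^ (((1 + d) ^ n - 1) / d) * a 0 := by
  obtain ⟨hγ0, -⟩ := omegaNewtonSeqPow_ratio hd ha0 ha h414a h414b
  rw [← hγ] at hγ0
  have hdne : d ≠ 0 := hd.ne'
  induction n with
  | zero =>
    apply le_of_eq
    rw [pow_zero, sub_self, zero_div, Real.rpow_zero, one_mul]
  | succ n ih =>
    have hs := omegaNewtonSeqPow_succ_le hd ha0 ha h414a h414b hγ n
    have hγp : 0 ≤ γ ^ ((1 + d) ^ n) := (Real.rpow_pos_of_pos hγ0 _).le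
    have e : (1 + d) ^ n + ((1 + d) ^ n - 1) / d = ((1 + d) ^ (n + 1) - 1) / d := by
      rw [eq_div_iff hdne, add_mul, div_mul_cancel₀ _ hdne]
      ring
    calc a (n + 1) ≤ γ ^ ((1 + d) ^ n) * a n := hs
      _ ≤ γ ^ ((1 + d) ^ n) * (γ ^ (((1 + d) ^ n - 1) / d) * a 0) :=
          mul_le_mul_of_nonneg_left ih hγp
      _ = γ ^ (((1 + d) ^ (n + 1) - 1) / d) * a 0 := by
          rw [← mul_assoc, ← Real.rpow_add hγ0, e]

end Pow

-- Canary (planted FALSE sharpening, kept commented; uncommented in the probe copy it must FAIL):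
-- example {d : ℝ} {a : ℕ → ℝ} (hd : 0 < d) (ha0 : 0 < a 0)
--     (ha : ∀ n, a (n + 1) = a n ^ (1 + d) * (1 / (1 - a n)) ^ (1 + d) / (1 + d) ^ d)
--     (h414a : a 0 ≤ (1 + d) / (2 + d)) (h414b : a 0 ^ d < (1 + d) ^ d * (1 - a 0) ^ (1 + d))
--     (n : ℕ) : a (n + 1) < a (n + 1) := by
--   have := (omegaNewtonSeqPow_bounds hd ha0.le ha h414a h414b n).2.2.1
--   linarith

end Literature.Analysis.Calculus
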